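import Literature.Barriers.NavierStokesRegularity.NavierStokesInequalityCantorArrangement
import HarnessLib

/-!
# The level data of a Cantor arrangement from its level fields: Ożański's §6.3 Step 3 (iv)

Support file on the discharge path of fact D′
`Literature.Barriers.NavierStokesRegularity.NSICantorBlock_of_arrangement` (the level data
`IsNSICantorLevelFields` of a geometric arrangement for Theorem 14 = (6.8)–(6.12) with
**Proposition 16**, `NavierStokesInequalityCantorArrangement`; W. S. Ożański, arXiv:1709.00602v4,
§6.2–§6.3; V. Scheffer, Comm. Math. Phys. 110 (1987), Lemma 5.5 with Lemmas 5.6–5.8). It is the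
FAR END of the printed proof of Proposition 16 (§6.3, "Fix `j ≥ 0`", Steps 1–3): once, for a
fixed level `j`, a field `v = v^{(j)}` with (i)–(iii) has been produced on the `𝔐 = Mʲ` axial
translates `K^𝔪` of `Ū₁ ∪ Ū₂` (Steps 1–2 and the first half of Step 3), claim (iv) is obtained
on p. 31–32 from two POINTWISE bounds that are uniform in `j`:

  "`|v(x,t)| ≤ Σ_𝔪 |h^𝔪_{1,t}(R⁻¹x) + h^𝔪_{2,t}(R⁻¹x)| + 1 ≤ sup_s ‖h_{1,s} + h_{2,s}‖_∞ + 1 = 𝒞`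
  … Hence, since `supp v(t) = ⋃_𝔪 R(K^𝔪)` consists of `𝔐` copies of `R(Ū₁ ∪ Ū₂)` … we obtain,
  by Hölder's inequality, that `‖v(t)‖_{L²} ≤ 𝔐𝒞` for `t ∈ [0,T]`", and
  "`|∇v(x,t)| ≤ … = 𝒞`, and therefore `∫₀ᵀ ‖∇v(t)‖²_{L²} dt ≤ 𝔐𝒞`, as required",

"`𝒞` a constant that is independent of `j`". This file renders that passage and the
bookkeeping over `j`:

* `IsNSICantorLevelField U₁ U₂ T τ M X z θ ν₀ h B₀ B₁ j W` — ONE level: the field `W = v^{(j)}`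
  (time first) with Prop. 16 (i)–(iii) exactly as in `IsNSICantorLevelFields` (smooth on
  `(-η, T+η) × ℝ³`, divergence free, `supp W(s) ⊆ ⋃_m (G + levelShift m • eZ)`, the values (ii) on
  each translate against the profile `h`, the pointwise Navier–Stokes inequality for
  `ν ∈ [0,ν₀]`) and, in place of (iv), the two pointwise bounds of p. 31–32:
  `|W(s,x)| ≤ B₀` and `|∇W(s,x)|² ≤ B₁` (`s ∈ [0,T]`; Frobenius norm, the integrand of (iv));
* PROVED, (iv) from the pointwise bounds (p. 31–32): `IsNSICantorLevelField.lintegral_enorm_sq_le`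
  — `∫|W(s)|² ≤ B₀² · Mʲ · |G|` — and `IsNSICantorLevelField.lintegral_dissipation_le` —
  `∫₀ᵀ∫|∇W|² ≤ T · B₁ · Mʲ · |G|` — through `volume_iUnion_translate_le`
  (`|⋃_m (G + c_m)| ≤ Mʲ|G|`, `m : Fin j → Fin M`; no disjointness needed);
* PROVED, the bookkeeping: `isNSICantorLevelFields_of_levelField` (level fields for every `j`
  with `j`-independent `θ, ν₀, h, B₀, B₁`, together with (6.8) `θ > 0`, (4.13) `ν₀ > 0`,
  `h₀ = f₁ + f₂` and the gain (6.12), ARE level data `IsNSICantorLevelFields`, with the constant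
  `𝒞 = max(B₀², T B₁)|G|` in (iv)), its existential form `exists_isNSICantorLevelFields_of_levelField`
  (the choice of `v^{(j)}` for each `j`), and the reduction of fact D′ to the levelwise statement,
  `nsiCantorBlock_of_arrangement_of_levelField`.

Deliberately NOT here: Steps 1–2 and the first half of Step 3 (the translated structures, the
profiles `q^{𝔪,k}`, Theorem 17, the verification of (i)–(iii) and of the two pointwise bounds
for `k` large) — the files `NavierStokesInequalityStructureTranslate`, `…CantorLevelH`,
`…CantorConvergence`, `…CantorOscillatoryProcesses` and their sequels.

## References

* W. S. Ożański, *On weak solutions to the Navier–Stokes inequality with internal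
  singularities*, arXiv:1709.00602v4 (2017/2019), §6.2 (Prop. 16 (i)–(iv)), §6.3 Step 3,
  pp. 31–32. [`Ozanski2017NSISingular`]
* V. Scheffer, *Nearly one dimensional singularities of solutions to the Navier–Stokes
  inequality*, Comm. Math. Phys. 110 (1987), 525–551: Lemma 5.5, Lemmas 5.6–5.8.
  [`Scheffer1987`]
-/

noncomputable section

open MeasureTheory Set Function Filter Topology TopologicalSpace WithLp Metric
open scoped ENNReal NNReal InnerProductSpace RealInnerProductSpace ContDiff Laplacian

namespace Literature.Barriers.NavierStokesRegularity

open Literature.Analysis.FluidPDE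

/-- Local notation for physical space `ℝ³ = EuclideanSpace ℝ (Fin 3)`. -/
local notation "ℝ³" => EuclideanSpace ℝ (Fin 3)

/-! ### The measure of a union of `Mʲ` translates -/

/-- Axial (indeed any) translation preserves Lebesgue measure: `|G + c| = |G|`. [folklore] -/
theorem volume_image_add_right (G : Set ℝ³) (c : ℝ³) :
    volume ((fun y : ℝ³ => y + c) '' G) = volume G := by
  rw [Set.image_add_right, measure_preimage_add_right]

/-- **`𝔐 = Mʲ` copies of `G` have measure at most `Mʲ|G|`**: for any family of translation
vectors `c m`, `m : Fin j → Fin M`, `|⋃_m (G + c_m)| ≤ Mʲ |G|` (subadditivity; Ożański p. 31: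
"`supp v(t) = ⋃_𝔪 R(K^𝔪)` consists of `𝔐` copies of `R(Ū₁ ∪ Ū₂)`").
[cite: Ozanski2017NSISingular, §6.3 Step 3, p. 31] -/
theorem volume_iUnion_translate_le (G : Set ℝ³) {M j : ℕ} (c : (Fin j → Fin M) → ℝ³) :
    volume (⋃ m : Fin j → Fin M, (fun y : ℝ³ => y + c m) '' G) ≤ (M : ℝ≥0∞) ^ j * volume G := by
  calc volume (⋃ m : Fin j → Fin M, (fun y : ℝ³ => y + c m) '' G)
      ≤ ∑ m : Fin j → Fin M, volume ((fun y : ℝ³ => y + c m) '' G) :=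
        measure_iUnion_fintype_le _ _
    _ = ∑ _m : Fin j → Fin M, volume G := by simp_rw [volume_image_add_right]
    _ = (M : ℝ≥0∞) ^ j * volume G := by
        rw [Finset.sum_const, Finset.card_univ, Fintype.card_fun, Fintype.card_fin,
          Fintype.card_fin, nsmul_eq_mul]
        push_cast
        ring

/-- **Hölder on the support**: a function bounded by `B` and vanishing off `S` has
`∫ |g|² ≤ B² |S|`. [folklore] -/
theorem lintegral_enorm_sq_le_of_norm_le {g : ℝ³ → ℝ³} {S : Set ℝ³} {B : ℝ}
    (hB : ∀ x, ‖g x‖ ≤ B) (hS : support g ⊆ S) :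
    ∫⁻ x, ‖g x‖ₑ ^ 2 ≤ ENNReal.ofReal (B ^ 2) * volume S := by
  have hsupp : support (fun x => ‖g x‖ₑ ^ 2) ⊆ S := by
    intro x hx
    apply hS
    rw [mem_support] at hx ⊢
    contrapose! hx
    simp [hx]
  rw [← setLIntegral_eq_of_support_subset hsupp]
  calc ∫⁻ x in S, ‖g x‖ₑ ^ 2 ≤ ∫⁻ _ in S, ENNReal.ofReal (B ^ 2) := by
        refine lintegral_mono fun x => ?_
        rw [← ofReal_norm, ← ENNReal.ofReal_pow (norm_nonneg _)]
        exact ENNReal.ofReal_le_ofReal (pow_le_pow_left₀ (norm_nonneg _) (hB x) 2)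
    _ = ENNReal.ofReal (B ^ 2) * volume S := setLIntegral_const _ _

/-- A nonnegative-valued integrand bounded by `B` and vanishing off `S` has `∫ g ≤ B |S|`
(the dissipation integrand). [folklore] -/
theorem lintegral_ofReal_le_of_le {g : ℝ³ → ℝ} {S : Set ℝ³} {B : ℝ}
    (hB : ∀ x, g x ≤ B) (hS : support g ⊆ S) :
    ∫⁻ x, ENNReal.ofReal (g x) ≤ ENNReal.ofReal B * volume S := by
  have hsupp : support (fun x => ENNReal.ofReal (g x)) ⊆ S := by
    intro x hx
    apply hS
    rw [mem_support] at hx ⊢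
    contrapose! hx
    simp [hx]
  rw [← setLIntegral_eq_of_support_subset hsupp]
  calc ∫⁻ x in S, ENNReal.ofReal (g x) ≤ ∫⁻ _ in S, ENNReal.ofReal B :=
        lintegral_mono fun x => ENNReal.ofReal_le_ofReal (hB x)
    _ = ENNReal.ofReal B * volume S := setLIntegral_const _ _

/-! ### One level of Proposition 16 with the pointwise bounds of Step 3 -/

/-- **One level of Proposition 16, with the pointwise bounds of §6.3 Step 3 in place of (iv).**
For a fixed `j ≥ 0`, the field `W = v^{(j)} ∈ C^∞(ℝ³ × [0,T]; ℝ³)` (time first) of Ożański's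
Proposition 16 on the `Mʲ` axial translates `G + levelShift τ X z m • eZ`, `m : Fin j → Fin M`, of
`G = R(Ū₁ ∪ Ū₂)` (§6.3 Step 1), with: smoothness on `(-η, T+η) × ℝ³` for some `η > 0`; (i)
`div W(s) = 0` and `supp W(s) ⊆ ⋃_m (G + levelShift • eZ)`, `s ∈ [0,T]`; (ii) on each translate
`|W(0, y + levelShift • eZ)| = h₀(R⁻¹y)` and `||W(s, y + levelShift • eZ)|² - h_s(R⁻¹y)²| < θ`
(`y ∈ G`, `s ∈ [0,T]`); (iii) the pointwise Navier–Stokes inequality on `[0,T] × ℝ³` for every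
`ν ∈ [0,ν₀]` with the pressure function `p̃[W(s)]` — these exactly as in `IsNSICantorLevelFields` —
and the two POINTWISE BOUNDS from which p. 31–32 derives (iv): `|W(s,x)| ≤ B₀` ("`|v(x,t)| ≤ … = 𝒞`")
and `|∇W(s,x)|² ≤ B₁` ("`|∇v(x,t)| ≤ … = 𝒞`"; squared Frobenius norm, the integrand of (iv)) for
`s ∈ [0,T]`, `x ∈ ℝ³`, the constants being "independent of `j`" when the same `B₀, B₁` are used at
every level. [cite: Ozanski2017NSISingular, Prop. 16 (i)–(iii) and §6.3 Step 3, pp. 31–32] -/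
structure IsNSICantorLevelField (U₁ U₂ : Set (ℝ × ℝ)) (T τ : ℝ) (M : ℕ) (X : ℝ) (z : ℝ³)
    (θ ν₀ : ℝ) (h : ℝ → ℝ × ℝ → ℝ) (B₀ B₁ : ℝ) (j : ℕ) (W : ℝ → ℝ³ → ℝ³) : Prop where
  /-- `v^{(j)} ∈ C^∞(ℝ³ × [0,T])`: jointly smooth on `(-η, T+η) × ℝ³` for some `η > 0`. -/
  smooth : ∃ η : ℝ, 0 < η ∧ IsSmoothSpaceTimeOn (Ioo (-η) (T + η)) W
  /-- (i): `div v^{(j)}(s) = 0`, `s ∈ [0,T]`. -/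
  divFree : ∀ s ∈ Icc (0 : ℝ) T, VectorCalculus.IsDivFree (W s)
  /-- (i): `supp v^{(j)}(s) ⊆ ⋃_m (G + levelShift • eZ)`, `s ∈ [0,T]`. -/
  tsupport_subset : ∀ s ∈ Icc (0 : ℝ) T, tsupport (W s) ⊆
    ⋃ m : Fin j → Fin M, (fun y : ℝ³ => y + levelShift τ X z m • EuclideanSpace.single 2 1) ''
      revolve (closure U₁ ∪ closure U₂)
  /-- (ii): `|v^{(j)}(0, y + levelShift • eZ)| = h₀(R⁻¹y)` for `y ∈ G`. -/
  norm_zero : ∀ y ∈ revolve (closure U₁ ∪ closure U₂), ∀ m : Fin j → Fin M,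
    ‖W 0 (y + levelShift τ X z m • EuclideanSpace.single 2 1)‖ = h 0 (meridian y)
  /-- (ii): `||v^{(j)}(s, y + levelShift • eZ)|² - h_s(R⁻¹y)²| < θ` for `y ∈ G`, `s ∈ [0,T]`. -/
  abs_sq_sub_lt : ∀ s ∈ Icc (0 : ℝ) T, ∀ y ∈ revolve (closure U₁ ∪ closure U₂),
    ∀ m : Fin j → Fin M,
    |‖W s (y + levelShift τ X z m • EuclideanSpace.single 2 1)‖ ^ 2 - h s (meridian y) ^ 2| < θ
  /-- (iii): the pointwise Navier–Stokes inequality on `[0,T] × ℝ³` for every `ν ∈ [0,ν₀]`. -/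
  nsi : ∀ ν ∈ Icc (0 : ℝ) ν₀, ∀ s ∈ Icc (0 : ℝ) T, ∀ x : ℝ³,
    timeDeriv (fun r y => ‖W r y‖ ^ 2) s x ≤
      -⟪W s x, gradient (fun y => ‖W s y‖ ^ 2 + 2 * normalisedPressure (W s) y) x⟫ +
        2 * ν * ⟪W s x, Δ (W s) x⟫
  /-- p. 31: `|v(x,t)| ≤ 𝒞` (`t ∈ [0,T]`). -/
  norm_le : ∀ s ∈ Icc (0 : ℝ) T, ∀ x : ℝ³, ‖W s x‖ ≤ B₀
  /-- p. 32: `|∇v(x,t)|² ≤ 𝒞` (`t ∈ [0,T]`; squared Frobenius norm of the derivative). -/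
  frobeniusNormSq_le : ∀ s ∈ Icc (0 : ℝ) T, ∀ x : ℝ³, frobeniusNormSq (fderiv ℝ (W s) x) ≤ B₁

namespace IsNSICantorLevelField

variable {U₁ U₂ : Set (ℝ × ℝ)} {T τ : ℝ} {M : ℕ} {X : ℝ} {z : ℝ³} {θ ν₀ : ℝ}
  {h : ℝ → ℝ × ℝ → ℝ} {B₀ B₁ : ℝ} {j : ℕ} {W : ℝ → ℝ³ → ℝ³}

/-- **(iv), the energy, from the pointwise bound** (p. 31: "`|v(x,t)| ≤ 𝒞` … since `supp v(t)`
consists of `𝔐` copies of `R(Ū₁ ∪ Ū₂)` we obtain, by Hölder's inequality, `‖v(t)‖_{L²} ≤ 𝔐𝒞`"):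
`∫ |W(s)|² ≤ B₀² · Mʲ · |G|` for `s ∈ [0,T]`. [cite: Ozanski2017NSISingular, §6.3 Step 3, p. 31] -/
theorem lintegral_enorm_sq_le (hW : IsNSICantorLevelField U₁ U₂ T τ M X z θ ν₀ h B₀ B₁ j W)
    {s : ℝ} (hs : s ∈ Icc (0 : ℝ) T) :
    ∫⁻ x, ‖W s x‖ₑ ^ 2 ≤
      ENNReal.ofReal (B₀ ^ 2) * ((M : ℝ≥0∞) ^ j * volume (revolve (closure U₁ ∪ closure U₂))) :=
  calc ∫⁻ x, ‖W s x‖ₑ ^ 2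
      ≤ ENNReal.ofReal (B₀ ^ 2) * volume (⋃ m : Fin j → Fin M,
          (fun y : ℝ³ => y + levelShift τ X z m • EuclideanSpace.single 2 1) ''
            revolve (closure U₁ ∪ closure U₂)) :=
        lintegral_enorm_sq_le_of_norm_le (hW.norm_le s hs)
          ((subset_tsupport _).trans (hW.tsupport_subset s hs))
    _ ≤ ENNReal.ofReal (B₀ ^ 2) * ((M : ℝ≥0∞) ^ j * volume (revolve (closure U₁ ∪ closure U₂))) :=
        mul_le_mul_of_nonneg_left (volume_iUnion_translate_le _ _) zero_le

/-- The dissipation integrand vanishes off the support of the field (`∇W(s) = 0` off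
`supp W(s)`), so at each time `∫ |∇W(s)|² ≤ B₁ · Mʲ · |G|`.
[cite: Ozanski2017NSISingular, §6.3 Step 3, p. 32] -/
theorem lintegral_frobeniusNormSq_le (hW : IsNSICantorLevelField U₁ U₂ T τ M X z θ ν₀ h B₀ B₁ j W)
    {s : ℝ} (hs : s ∈ Icc (0 : ℝ) T) :
    ∫⁻ x, ENNReal.ofReal (frobeniusNormSq (fderiv ℝ (W s) x)) ≤
      ENNReal.ofReal B₁ * ((M : ℝ≥0∞) ^ j * volume (revolve (closure U₁ ∪ closure U₂))) := by
  have hsupp : support (fun x => frobeniusNormSq (fderiv ℝ (W s) x)) ⊆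
      ⋃ m : Fin j → Fin M, (fun y : ℝ³ => y + levelShift τ X z m • EuclideanSpace.single 2 1) ''
        revolve (closure U₁ ∪ closure U₂) := by
    intro x hx
    apply hW.tsupport_subset s hs
    apply support_fderiv_subset ℝ
    rw [mem_support] at hx ⊢
    contrapose! hx
    rw [hx, frobeniusNormSq_zero]
  calc ∫⁻ x, ENNReal.ofReal (frobeniusNormSq (fderiv ℝ (W s) x))
      ≤ ENNReal.ofReal B₁ * volume (⋃ m : Fin j → Fin M,
          (fun y : ℝ³ => y + levelShift τ X z m • EuclideanSpace.single 2 1) ''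
            revolve (closure U₁ ∪ closure U₂)) :=
        lintegral_ofReal_le_of_le (hW.frobeniusNormSq_le s hs) hsupp
    _ ≤ ENNReal.ofReal B₁ * ((M : ℝ≥0∞) ^ j * volume (revolve (closure U₁ ∪ closure U₂))) :=
        mul_le_mul_of_nonneg_left (volume_iUnion_translate_le _ _) zero_le

/-- **(iv), the dissipation, from the pointwise bound** (p. 32: "`|∇v(x,t)| ≤ … = 𝒞`, and
therefore `∫₀ᵀ‖∇v(t)‖²_{L²} dt ≤ 𝔐𝒞`"): `∫₀ᵀ∫ |∇W|² ≤ T · B₁ · Mʲ · |G|`.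
[cite: Ozanski2017NSISingular, §6.3 Step 3, p. 32] -/
theorem lintegral_dissipation_le (hW : IsNSICantorLevelField U₁ U₂ T τ M X z θ ν₀ h B₀ B₁ j W) :
    (∫⁻ s in Icc (0 : ℝ) T, ∫⁻ x, ENNReal.ofReal (frobeniusNormSq (fderiv ℝ (W s) x))) ≤
      ENNReal.ofReal T * (ENNReal.ofReal B₁ *
        ((M : ℝ≥0∞) ^ j * volume (revolve (closure U₁ ∪ closure U₂)))) := by
  obtain ⟨η, hη, -⟩ := hW.smooth
  calc (∫⁻ s in Icc (0 : ℝ) T, ∫⁻ x, ENNReal.ofReal (frobeniusNormSq (fderiv ℝ (W s) x)))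
      ≤ ∫⁻ _ in Icc (0 : ℝ) T, ENNReal.ofReal B₁ *
          ((M : ℝ≥0∞) ^ j * volume (revolve (closure U₁ ∪ closure U₂))) :=
        setLIntegral_mono' measurableSet_Icc fun s hs => hW.lintegral_frobeniusNormSq_le hs
    _ ≤ ENNReal.ofReal T * (ENNReal.ofReal B₁ *
          ((M : ℝ≥0∞) ^ j * volume (revolve (closure U₁ ∪ closure U₂)))) := by
        rw [setLIntegral_const, Real.volume_Icc, sub_zero, mul_comm]

end IsNSICantorLevelField

/-! ### The level data from the level fields -/

section Assembly

variable {U₁ U₂ : Set (ℝ × ℝ)} {f₁ f₂ : ℝ × ℝ → ℝ} {T τ : ℝ} {M : ℕ} {X : ℝ} {z : ℝ³} {θ ν₀ : ℝ}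
  {h : ℝ → ℝ × ℝ → ℝ} {B₀ B₁ : ℝ} {V : ℕ → ℝ → ℝ³ → ℝ³}

/-- **Level fields for every `j`, with `j`-independent constants, are level data**
(Ożański 2017, §6.2–§6.3: Proposition 16 is proved level by level, "`𝒞` a constant that is
independent of `j`"; the constant of (iv) is `𝒞 = max(B₀², T·B₁)·|G|`, `G` being compact).
Hypotheses: (6.8) `θ > 0`, (4.13) `ν₀ > 0`, `h₀ = f₁ + f₂`, the gain (6.12), `G` compact, and a
level field at every level. [cite: Ozanski2017NSISingular, §6.2 (6.8)–(6.12), Prop. 16, §6.3 Step 3] -/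
theorem isNSICantorLevelFields_of_levelField (hθ : 0 < θ) (hν₀ : 0 < ν₀)
    (h_zero : ∀ q, h 0 q = f₁ q + f₂ q)
    (gain : ∀ x ∈ revolve (closure U₁ ∪ closure U₂), ∀ n : Fin M,
      τ⁻¹ ^ 2 * h 0 (meridian x) ^ 2 + θ < h T (meridian (τ • x + cantorTranslate X z M n)) ^ 2)
    (hG : IsCompact (revolve (closure U₁ ∪ closure U₂)))
    (hV : ∀ j : ℕ, IsNSICantorLevelField U₁ U₂ T τ M X z θ ν₀ h B₀ B₁ j (V j)) :
    IsNSICantorLevelFields U₁ U₂ f₁ f₂ T τ M X z θ ν₀ h V := by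
  have hGtop : volume (revolve (closure U₁ ∪ closure U₂)) ≠ ⊤ := hG.measure_lt_top.ne
  refine
    { θ_pos := hθ
      ν₀_pos := hν₀
      h_zero := h_zero
      gain := gain
      smooth := fun j => (hV j).smooth
      divFree := fun j => (hV j).divFree
      tsupport_subset := fun j => (hV j).tsupport_subset
      norm_zero := fun j => (hV j).norm_zero
      abs_sq_sub_lt := fun j => (hV j).abs_sq_sub_lt
      nsi := fun j => (hV j).nsi
      energy := ?_
      dissipation := ?_ }
  · -- `𝒞 = B₀²|G|`
    refine ⟨(ENNReal.ofReal (B₀ ^ 2) * volume (revolve (closure U₁ ∪ closure U₂))).toNNReal,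
      fun j s hs => ?_⟩
    rw [ENNReal.coe_toNNReal (ENNReal.mul_ne_top ENNReal.ofReal_ne_top hGtop)]
    calc ∫⁻ x, ‖V j s x‖ₑ ^ 2
        ≤ ENNReal.ofReal (B₀ ^ 2) * ((M : ℝ≥0∞) ^ j * volume (revolve (closure U₁ ∪ closure U₂))) :=
          (hV j).lintegral_enorm_sq_le hs
      _ = ENNReal.ofReal (B₀ ^ 2) * volume (revolve (closure U₁ ∪ closure U₂)) * (M : ℝ≥0∞) ^ j := by
          ring
  · -- `𝒞 = T B₁ |G|`
    refine ⟨(ENNReal.ofReal T * (ENNReal.ofReal B₁ * volume (revolve (closure U₁ ∪ closure U₂)))).toNNReal,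
      fun j => ?_⟩
    rw [ENNReal.coe_toNNReal (ENNReal.mul_ne_top ENNReal.ofReal_ne_top
      (ENNReal.mul_ne_top ENNReal.ofReal_ne_top hGtop))]
    calc (∫⁻ s in Icc (0 : ℝ) T, ∫⁻ x, ENNReal.ofReal (frobeniusNormSq (fderiv ℝ (V j s) x)))
        ≤ ENNReal.ofReal T * (ENNReal.ofReal B₁ *
            ((M : ℝ≥0∞) ^ j * volume (revolve (closure U₁ ∪ closure U₂)))) :=
          (hV j).lintegral_dissipation_le
      _ = ENNReal.ofReal T * (ENNReal.ofReal B₁ * volume (revolve (closure U₁ ∪ closure U₂))) *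
            (M : ℝ≥0∞) ^ j := by
          ring

/-- **The choice of `v^{(j)}` for each `j`**: if every level carries some level field (with
`j`-independent `θ, ν₀, h, B₀, B₁`), the arrangement carries level data.
[cite: Ozanski2017NSISingular, §6.2 Prop. 16 ("For each `j ≥ 0` there exists `v^{(j)}` …")] -/
theorem exists_isNSICantorLevelFields_of_levelField (hθ : 0 < θ) (hν₀ : 0 < ν₀)
    (h_zero : ∀ q, h 0 q = f₁ q + f₂ q)
    (gain : ∀ x ∈ revolve (closure U₁ ∪ closure U₂), ∀ n : Fin M,
      τ⁻¹ ^ 2 * h 0 (meridian x) ^ 2 + θ < h T (meridian (τ • x + cantorTranslate X z M n)) ^ 2)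
    (hG : IsCompact (revolve (closure U₁ ∪ closure U₂)))
    (hV : ∀ j : ℕ, ∃ W : ℝ → ℝ³ → ℝ³, IsNSICantorLevelField U₁ U₂ T τ M X z θ ν₀ h B₀ B₁ j W) :
    ∃ V : ℕ → ℝ → ℝ³ → ℝ³, IsNSICantorLevelFields U₁ U₂ f₁ f₂ T τ M X z θ ν₀ h V := by
  choose V hV using hV
  exact ⟨V, isNSICantorLevelFields_of_levelField hθ hν₀ h_zero gain hG hV⟩

end Assembly

/-- **Fact D′ reduced to the levelwise statement of Proposition 16 with the pointwise bounds of
Step 3**: if every geometric arrangement for Theorem 14 carries `θ > 0` ((6.8)), `ν₀ > 0`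
((4.13)), a profile `h` with `h₀ = f₁ + f₂` and the gain (6.12), and constants `B₀, B₁` such that
EVERY level `j` carries a level field `IsNSICantorLevelField … B₀ B₁ j W` (Prop. 16 (i)–(iii) and
`|W| ≤ B₀`, `|∇W|² ≤ B₁`), then `NSICantorBlock_of_arrangement` holds.
[cite: Ozanski2017NSISingular, §6.2 ((6.8)–(6.12), Prop. 16) and §6.3 Step 3] -/
theorem nsiCantorBlock_of_arrangement_of_levelField
    (H : ∀ (U₁ U₂ : Set (ℝ × ℝ)) (v₁ : ℝ × ℝ → ℝ × ℝ) (f₁ φ₁ : ℝ × ℝ → ℝ) (v₂ : ℝ × ℝ → ℝ × ℝ)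
      (f₂ φ₂ : ℝ × ℝ → ℝ) (T τ : ℝ) (M : ℕ) (X : ℝ) (z : ℝ³),
      IsNSICantorArrangement U₁ U₂ v₁ f₁ φ₁ v₂ f₂ φ₂ T τ M X z →
      ∃ (θ ν₀ : ℝ) (h : ℝ → ℝ × ℝ → ℝ) (B₀ B₁ : ℝ), 0 < θ ∧ 0 < ν₀ ∧
        (∀ q, h 0 q = f₁ q + f₂ q) ∧
        (∀ x ∈ revolve (closure U₁ ∪ closure U₂), ∀ n : Fin M,
          τ⁻¹ ^ 2 * h 0 (meridian x) ^ 2 + θ <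
            h T (meridian (τ • x + cantorTranslate X z M n)) ^ 2) ∧
        ∀ j : ℕ, ∃ W : ℝ → ℝ³ → ℝ³, IsNSICantorLevelField U₁ U₂ T τ M X z θ ν₀ h B₀ B₁ j W) :
    NSICantorBlock_of_arrangement := by
  intro U₁ U₂ v₁ f₁ φ₁ v₂ f₂ φ₂ T τ M X z hA
  obtain ⟨θ, ν₀, h, B₀, B₁, hθ, hν₀, h_zero, gain, hW⟩ := H U₁ U₂ v₁ f₁ φ₁ v₂ f₂ φ₂ T τ M X z hA
  obtain ⟨V, hV⟩ := exists_isNSICantorLevelFields_of_levelField hθ hν₀ h_zero gain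
    hA.isCompact_revolve hW
  exact ⟨θ, ν₀, h, V, hV⟩

end Literature.Barriers.NavierStokesRegularity
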